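import Summits.QuantumFields.YangMills.Theorems.BalabanUVNodesN15TwoGridAveragingDefect
import HarnessLib

/-!
# N15 (NE2) — Bałaban's full propagator pair, part N-IIs: ★★ THE TWO-GRID OPERATOR LETTER OF BAŁABAN's AVERAGING `a•Q*Q` ON ROUGH INPUTS (rate `η = (L^k)⁻¹`)

WHO ∕ WHEN.  Cell `pub-ymgap`, seat `pub-ymgap-dag-n15-a` (g22); `--supports stmt-QuantumFields-27366 --as helper` (count-neutral).  Answers dag-n15-c's WANT g13-2 (β) («an
OPERATOR two-grid letter of Bałaban's averaging on ROUGH inputs, `𝔇(a•Q′*Q′, a•Q*Q) ≤ C·(L^k)^{−γ}·e^{−ρd}`») and corrects the aside of N-IIm («`Q*Q` has no two-grid operator letter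
on rough inputs» — too pessimistic: it has one, at rate `η`).
WHAT.  The exact mechanism: for a coarse 1-form `A` and a unit bond `(y, κ)`, `(Q′PA − QA)(y,κ) = (n′)⁻¹·((L^m−1)∕2)·avg_{x∈B(y)}(A(x + n e_κ) − A(x))` — the fine contour from a point with
κ-offset `o` in its cell visits the cells `c₀` (`L^m − o` times), `c₁,…,c_{n−1}` (`L^m` times) and `c_n` (`o` times), so NO oscillation of `A` is needed, only `|A|`.  In part 57's
symbols: `(n⁻¹ρ(sD_κ n))∘ρ(a_κ(n)) = n⁻¹(ρ(s_κ^n) − 1)` (`(s − 1)·Σ_{j<n}s^j = s^n − 1`, §1 `sD_mul_sA_eq`), so part 57's proof of `hasMaj_qvRe_pull_sub_comp` runs with the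
a-priori bound `(2e^{ρ}∕n)·B` in place of the one-step oscillation: ★ `hasMaj_qvRe_pull_sub_rough` (§2).  With part 57's `hasMaj_qvAdjRe_sub_pull_comp` (`Q′* − PQ* ≤ 2e^{ρ}∕L^k`),
`hasMaj_qvRe_comp`, `hasMaj_qvAdjRe_comp` and the split `Q′*Q′P − PQ*Q = Q′*(Q′P − Q) + (Q′* − PQ*)Q`: ★★ **`hasMaj_idef_qvAdjRe_qvRe_rough`**:
`HasMaj (ofBlocks blkFine) (ofBlocks blockOf′) (idef P P (a•(Q′*∘Q′)) (a•(Q*∘Q))) (|a|·(4e^{2ρ}∕L^k)·e^{−ρ|y−y′|_T})` for every `ρ ≥ 0` — range one, rate `η`.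
HONEST FRAMING ∕ LIMITS.  Lattice algebra + block-majorant bookkeeping over part 57; no analytic estimate; `U ≡ 1` torus MODEL of [B5] §1 (`Q = Q_k` of (1.18) at `U ≡ 1`, King's
pairing); nothing of [B6]∕[B9] asserted; N15 NOT discharged (object-bound; NE2⁺ NOT PRINTED); counts UNMOVED (typed 28∕28 · discharged 5∕27); finite tori — NOT continuum ∕ ℝ⁴ ∕ OS ∕
mass gap ∕ Clay.  Theorems only (0 `def`).
-/

open scoped BigOperators Matrix
open Finset

namespace Summit.QuantumFields.YangMills.BalabanUVNodes.N15.TwoGrid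

open Literature.MathematicalPhysics.QuantumFieldTheory.Balaban1983to89
open Literature.MathematicalPhysics.QuantumFieldTheory.Balaban1983to89.B11SectG (BlockNorm HasMaj)
open Literature.MathematicalPhysics.QuantumFieldTheory.Balaban1983to89.B11AxialTransport190 (abs_le_loc_ofBlocks loc_ofBlocks_le)
open Literature.MathematicalPhysics.QuantumFieldTheory.Balaban1983to89.T4EtaRateDefect (idef)
open Literature.MathematicalPhysics.QuantumFieldTheory.Balaban1983to89.T4EtaRateCoeffDefect (pull pull_apply)
open Literature.MathematicalPhysics.QuantumFieldTheory.Balaban1983to89.B5Prop11Plancherel (Tor fine unitVec)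
open Literature.MathematicalPhysics.QuantumFieldTheory.King1986.Torus (blockOf tdistT tdistT_nonneg tdistT_symm tdistT_self)
open Literature.MathematicalPhysics.QuantumFieldTheory.Balaban1983to89.B6UnitTorusCarrier (unitTorusGeo)
open Summit.QuantumFields.YangMills.BalabanUVNodes.N15.VectorPiece (blkFine kingPrV blkFine_comp_kingPrV)

variable {d : ℕ}

/-! ## §1 `(s_κ − 1)·a_κ(n) = n⁻¹(s_κ^n − 1)` -/

section Symbols

variable (M : Fin (d + 1) → ℕ) [∀ μ, NeZero (M μ)] (n : ℕ) [NeZero n]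

omit [∀ μ, NeZero (M μ)] [NeZero n] in
/-- `(s_κ − 1)·a_κ(R) = R⁻¹·(s_κ^R − 1)`: the one-step difference of the `R`-step box filter telescopes (`geom_sum_mul`). [folklore] -/
theorem sT_sub_one_mul_sA (κ : Fin (d + 1)) (R : ℕ) :
    (sT M n κ ^ 1 - 1) * sA M n κ R = (R : ℝ)⁻¹ • (sT M n κ ^ R - 1) := by
  rw [sA, mul_smul_comm, pow_one, mul_comm, geom_sum_mul]

omit [∀ μ, NeZero (M μ)] in
/-- `(n⁻¹ρ(sD_κ n))∘ρ(a_κ(R)) = R⁻¹·(ρ(s_κ^R) − 1)`. [folklore] -/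
theorem inv_smul_symbOp_sD_comp_sA (κ : Fin (d + 1)) (R : ℕ) :
    (((n : ℕ) : ℝ)⁻¹ • symbOp M n (sD M n κ ((n : ℕ) : ℝ))) ∘ₗ symbOp M n (sA M n κ R)
      = (R : ℝ)⁻¹ • (symbOp M n (sT M n κ ^ R) - 1) := by
  have hn : (((n : ℕ) : ℝ)) ≠ 0 := by exact_mod_cast NeZero.ne n
  have e0 : ((n : ℕ) : ℝ)⁻¹ • symbOp M n (sD M n κ ((n : ℕ) : ℝ)) = symbOp M n (sT M n κ ^ 1 - 1) := by
    rw [sD, map_smul, smul_smul, inv_mul_cancel₀ hn, one_smul, pow_one]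
  rw [e0, ← Module.End.mul_eq_comp, ← map_mul, sT_sub_one_mul_sA, map_smul, map_sub, map_one]

end Symbols

/-! ## §2 ★ `Q′P − Q` on rough inputs -/

section Rough

variable {L : ℕ} (M : Fin (d + 1) → ℕ) [∀ μ, NeZero (M μ)] (k : ℕ) {F₁ : Type} [AddCommGroup F₁] [Module ℝ F₁] (m : ℕ) [NeZero L]

/-- ★ **THE TWO-GRID CONSISTENCY OF `Q` ON ROUGH INPUTS**: if `S` has majorant `B·e^{−ρd}` into coarse 1-forms blocked by King's unit blocks, then `(Q′∘P − Q)∘S` (`Q′ = qvRe M (L^m·L^k)`,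
`Q = qvRe M (L^k)`) has majorant `(2e^{ρ}∕L^k)·B·e^{−ρd}` into unit-lattice 1-forms — part 57's proof with `(η∇_κ)∘ρ(a_κ) = (L^k)⁻¹(ρ(s_κ^{L^k}) − 1)` (§1) bounded a priori
(`hasMaj_sT_pow_comp`) instead of through the one-step oscillation of `S`; the conclusion is `(2e^{ρ}∕L^k)·B·e^{−ρd}`. [cite: Balaban1984PropagatorsI, (1.18) p.20; King1986, p.664 (the pairing), Prop. 3.9 p.665 (η-rate shape)] -/
theorem hasMaj_qvRe_pull_sub_rough {b₁ : BlockNorm (unitTorusGeo L k M) F₁} {S : F₁ →ₗ[ℝ] (Tor (fine (L ^ k) M) × Fin (d + 1) → ℝ)} {B ρ : ℝ} (hB : 0 ≤ B) (hρ : 0 ≤ ρ)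
    (h : HasMaj b₁ (BlockNorm.ofBlocks (unitTorusGeo L k M) (blkFine L k M)) S (fun y y' => B * Real.exp (-(ρ * tdistT M y y')))) :
    HasMaj b₁ (BlockNorm.ofBlocks (unitTorusGeo L k M) (fun b : Tor M × Fin (d + 1) => b.1))
      ((qvRe M (L ^ m * L ^ k) ∘ₗ pull (kingPrV L k m M) - qvRe M (L ^ k)) ∘ₗ S)
      (fun y y' => 2 * Real.exp ρ / ((L ^ k : ℕ) : ℝ) * B * Real.exp (-(ρ * tdistT M y y'))) := by
  classical
  haveI : NeZero (L ^ k) := ⟨pow_ne_zero k (NeZero.ne L)⟩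
  have hL0 : 0 < L := Nat.pos_of_ne_zero (NeZero.ne L)
  have hR0 : L ^ m ≠ 0 := by positivity
  have hR' : (0 : ℝ) < ((L ^ m : ℕ) : ℝ) := by exact_mod_cast Nat.pos_of_ne_zero hR0
  have hn0 : (0 : ℝ) < ((L ^ k : ℕ) : ℝ) := by exact_mod_cast Nat.one_le_pow _ _ hL0
  obtain ⟨B', hB'⟩ : ∃ B' : ℝ, B' = 2 * Real.exp ρ / ((L ^ k : ℕ) : ℝ) * B := ⟨_, rfl⟩
  have hB'0 : 0 ≤ B' := by rw [hB']; positivity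
  have hK0 : ∀ y y' : Tor M, 0 ≤ B' * Real.exp (-(ρ * tdistT M y y')) := fun y y' => mul_nonneg hB'0 (Real.exp_nonneg _)
  have hE0 : ∀ y y' : Tor M, 0 ≤ Real.exp (-(ρ * tdistT M y y')) := fun _ _ => Real.exp_nonneg _
  -- per direction `κ`: the operator `E_κ := ρ′(a′_κ(L^m) − 1)∘P∘ρ(a_κ(L^k))∘S` and its majorant
  have hE : ∀ κ : Fin (d + 1), HasMaj b₁ (BlockNorm.ofBlocks (unitTorusGeo L k M) (fun i : Tor (fine (L ^ m * L ^ k) M) × Fin (d + 1) => blockOf (L ^ m * L ^ k) M i.1))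
      (symbOp M (L ^ m * L ^ k) (sA M (L ^ m * L ^ k) κ (L ^ m) - 1) ∘ₗ (pull (kingPrV L k m M) ∘ₗ (symbOp M (L ^ k) (sA M (L ^ k) κ (L ^ k)) ∘ₗ S)))
      (fun y y' => B' * Real.exp (-(ρ * tdistT M y y'))) := by
    intro κ
    -- `η∇_κ(ρ(a_κ)S) = (L^k)⁻¹(ρ(s_κ^{L^k}) − 1)S` has majorant `(2e^{ρ}∕L^k)·B·e^{−ρd}` — NO oscillation of `S`
    have hshift := hasMaj_sT_pow_comp M k (L ^ k) (b₁ := b₁) hB hρ κ (j := L ^ k) le_rfl h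
    have hdiff := hshift.sub h
    have hsm := hasMaj_smul_ofBlocks (g := unitTorusGeo L k M) (b₁ := b₁) (fun i : Tor (fine (L ^ k) M) × Fin (d + 1) => blockOf (L ^ k) M i.1)
      (fun y y' => add_nonneg (mul_nonneg (mul_nonneg hB (Real.exp_nonneg _)) (hE0 y y')) (mul_nonneg hB (hE0 y y'))) (((L ^ k : ℕ) : ℝ))⁻¹ hdiff
    have hAS : HasMaj b₁ (BlockNorm.ofBlocks (unitTorusGeo L k M) (blkFine L k M))
        ((((L ^ k : ℕ) : ℝ)⁻¹ • symbOp M (L ^ k) (sD M (L ^ k) κ ((L ^ k : ℕ) : ℝ))) ∘ₗ (symbOp M (L ^ k) (sA M (L ^ k) κ (L ^ k)) ∘ₗ S))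
        (fun y y' => B' * Real.exp (-(ρ * tdistT M y y'))) := by
      refine (hsm.congr fun μ => ?_).mono fun y y' => ?_
      · have e := LinearMap.congr_fun (inv_smul_symbOp_sD_comp_sA M (L ^ k) κ (L ^ k)) (S μ)
        rw [LinearMap.comp_apply] at e
        rw [LinearMap.comp_apply, LinearMap.comp_apply, e]
        simp only [LinearMap.smul_apply, LinearMap.sub_apply, Module.End.one_apply, LinearMap.comp_apply]
      · rw [hB', abs_of_nonneg (inv_nonneg.mpr hn0.le)]
        have h1 : Real.exp (-(ρ * tdistT M y y')) ≤ Real.exp ρ * Real.exp (-(ρ * tdistT M y y')) :=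
          le_mul_of_one_le_left (hE0 y y') (Real.one_le_exp hρ)
        have : B * Real.exp (-(ρ * tdistT M y y')) ≤ B * (Real.exp ρ * Real.exp (-(ρ * tdistT M y y'))) := mul_le_mul_of_nonneg_left h1 hB
        calc (((L ^ k : ℕ) : ℝ))⁻¹ * (B * Real.exp ρ * Real.exp (-(ρ * tdistT M y y')) + B * Real.exp (-(ρ * tdistT M y y')))
            ≤ (((L ^ k : ℕ) : ℝ))⁻¹ * (B * Real.exp ρ * Real.exp (-(ρ * tdistT M y y')) + B * (Real.exp ρ * Real.exp (-(ρ * tdistT M y y')))) := by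
              gcongr
          _ = 2 * Real.exp ρ / ((L ^ k : ℕ) : ℝ) * B * Real.exp (-(ρ * tdistT M y y')) := by rw [div_eq_mul_inv]; ring
    have hJ : ∀ j ∈ range (L ^ m), HasMaj b₁ (BlockNorm.ofBlocks (unitTorusGeo L k M) (fun i : Tor (fine (L ^ m * L ^ k) M) × Fin (d + 1) => blockOf (L ^ m * L ^ k) M i.1))
        ((symbOp M (L ^ m * L ^ k) (sT M (L ^ m * L ^ k) κ ^ j) ∘ₗ pull (kingPrV L k m M) - pull (kingPrV L k m M)) ∘ₗ (symbOp M (L ^ k) (sA M (L ^ k) κ (L ^ k)) ∘ₗ S))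
        (fun y y' => B' * Real.exp (-(ρ * tdistT M y y'))) :=
      fun j hj => hasMaj_shiftPull_sub M k m hK0 κ (mem_range.mp hj).le hAS
    have hsumJ := hasMaj_finsum (g := unitTorusGeo L k M) (b₁ := b₁)
      (b₂ := BlockNorm.ofBlocks (unitTorusGeo L k M) (fun i : Tor (fine (L ^ m * L ^ k) M) × Fin (d + 1) => blockOf (L ^ m * L ^ k) M i.1)) (range (L ^ m))
      (fun j => (symbOp M (L ^ m * L ^ k) (sT M (L ^ m * L ^ k) κ ^ j) ∘ₗ pull (kingPrV L k m M) - pull (kingPrV L k m M)) ∘ₗ (symbOp M (L ^ k) (sA M (L ^ k) κ (L ^ k)) ∘ₗ S))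
      (fun _ y y' => B' * Real.exp (-(ρ * tdistT M y y'))) hJ
    refine ((hasMaj_smul_ofBlocks (g := unitTorusGeo L k M) (fun i : Tor (fine (L ^ m * L ^ k) M) × Fin (d + 1) => blockOf (L ^ m * L ^ k) M i.1)
      (fun y y' => sum_nonneg fun _ _ => hK0 y y') (((L ^ m : ℕ) : ℝ)⁻¹) hsumJ).congr fun μ => ?_).mono fun y y' => le_of_eq ?_
    · rw [sA_sub_one M (L ^ m * L ^ k) κ hR0]
      simp only [LinearMap.smul_apply, LinearMap.sum_apply, LinearMap.comp_apply, LinearMap.sub_apply, map_smul, map_sum, map_sub, map_one,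
        Module.End.one_apply]
    · rw [sum_const, card_range, nsmul_eq_mul, abs_of_nonneg (inv_nonneg.mpr hR'.le), ← mul_assoc, inv_mul_cancel₀ hR'.ne', one_mul]
  intro y' μ hμ y
  have hK0' : 0 ≤ 2 * Real.exp ρ / ((L ^ k : ℕ) : ℝ) * B * Real.exp (-(ρ * tdistT M y y')) := by rw [← hB']; exact hK0 y y'
  refine loc_ofBlocks_le (g := unitTorusGeo L k M) (fun b : Tor M × Fin (d + 1) => b.1) _ (mul_nonneg hK0' (b₁.loc_nonneg y' μ)) fun b hb => ?_
  rw [LinearMap.comp_apply, LinearMap.sub_apply, LinearMap.comp_apply, Pi.sub_apply, qvRe_pull_sub_apply]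
  calc |qsOp M (L ^ m * L ^ k) (symbOp M (L ^ m * L ^ k) (sA M (L ^ m * L ^ k) b.2 (L ^ m) - 1)
          (pull (kingPrV L k m M) (symbOp M (L ^ k) (sA M (L ^ k) b.2 (L ^ k)) (S μ)))) b|
      ≤ (BlockNorm.ofBlocks (unitTorusGeo L k M) (fun i : Tor (fine (L ^ m * L ^ k) M) × Fin (d + 1) => blockOf (L ^ m * L ^ k) M i.1)).loc b.1
          ((symbOp M (L ^ m * L ^ k) (sA M (L ^ m * L ^ k) b.2 (L ^ m) - 1) ∘ₗ (pull (kingPrV L k m M) ∘ₗ (symbOp M (L ^ k) (sA M (L ^ k) b.2 (L ^ k)) ∘ₗ S))) μ) :=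
        abs_qsOp_apply_le M k (L ^ m * L ^ k) _ b
    _ ≤ 2 * Real.exp ρ / ((L ^ k : ℕ) : ℝ) * B * Real.exp (-(ρ * tdistT M y y')) * b₁.loc y' μ := by rw [hb, ← hB']; exact hE b.2 y' μ hμ y

/-! ## §3 ★★ The operator two-grid letter of `a•Q*Q` on rough inputs -/

/-- the identity has the block majorant `e^{−ρd}` (any `ρ ≥ 0`): a source localised in block `y′` is seen only in block `y′`. [folklore] -/
theorem hasMaj_id_blkFine (ρ : ℝ) :
    HasMaj (BlockNorm.ofBlocks (unitTorusGeo L k M) (blkFine L k M)) (BlockNorm.ofBlocks (unitTorusGeo L k M) (blkFine L k M))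
      (LinearMap.id : (Tor (fine (L ^ k) M) × Fin (d + 1) → ℝ) →ₗ[ℝ] (Tor (fine (L ^ k) M) × Fin (d + 1) → ℝ))
      (fun y y' => 1 * Real.exp (-(ρ * tdistT M y y'))) := by
  classical
  intro y' μ hμ y
  dsimp only
  rw [one_mul]
  by_cases hy : y = y'
  · subst hy
    rw [tdistT_self, mul_zero, neg_zero, Real.exp_zero, one_mul]
    exact le_rfl
  · have h0 : (BlockNorm.ofBlocks (unitTorusGeo L k M) (blkFine L k M)).loc y
        ((LinearMap.id : (Tor (fine (L ^ k) M) × Fin (d + 1) → ℝ) →ₗ[ℝ] (Tor (fine (L ^ k) M) × Fin (d + 1) → ℝ)) μ) = 0 := by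
      refine le_antisymm (loc_ofBlocks_le (g := unitTorusGeo L k M) (blkFine L k M) _ le_rfl fun x hx => ?_)
        ((BlockNorm.ofBlocks (unitTorusGeo L k M) (blkFine L k M)).loc_nonneg y _)
      rw [LinearMap.id_apply, hμ x (by rw [hx]; exact hy), abs_zero]
    rw [h0]
    exact mul_nonneg (Real.exp_nonneg _) ((BlockNorm.ofBlocks (unitTorusGeo L k M) (blkFine L k M)).loc_nonneg y' μ)

/-- ★★ **THE TWO-GRID OPERATOR LETTER OF BAŁABAN's AVERAGING ON ROUGH INPUTS** (dag-n15-c's WANT g13-2 (β)): for every `ρ ≥ 0` and `a`,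
`𝔇(a•Q′*Q′, a•Q*Q) = a·(Q′*Q′P − PQ*Q) ≤ |a|·(4e^{2ρ}∕L^k)·e^{−ρ|y−y′|_T}` from coarse 1-forms in King's unit blocks (sup) to fine 1-forms on unit blocks (sup) — range one,
rate `η = (L^k)⁻¹`, NO oscillation of the input: `Q′*Q′P − PQ*Q = Q′*∘(Q′P − Q) + (Q′* − PQ*)∘Q` with §2 and part 57. [cite: Balaban1984PropagatorsI, (1.18) p.20 (Q_k);
Balaban1985BackgroundPropagators, Thm 3.1 (3.42) p.397 (two-grid template); King1986, p.664, Prop. 3.9 p.665] -/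
theorem hasMaj_idef_qvAdjRe_qvRe_rough (a : ℝ) {ρ : ℝ} (hρ : 0 ≤ ρ) :
    HasMaj (BlockNorm.ofBlocks (unitTorusGeo L k M) (blkFine L k M))
      (BlockNorm.ofBlocks (unitTorusGeo L k M) (fun i : Tor (fine (L ^ m * L ^ k) M) × Fin (d + 1) => blockOf (L ^ m * L ^ k) M i.1))
      (idef (pull (kingPrV L k m M)) (pull (kingPrV L k m M))
        (a • (qvAdjRe M (L ^ m * L ^ k) ∘ₗ qvRe M (L ^ m * L ^ k))) (a • (qvAdjRe M (L ^ k) ∘ₗ qvRe M (L ^ k))))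
      (fun y y' => |a| * (4 * Real.exp ρ * Real.exp ρ / ((L ^ k : ℕ) : ℝ)) * Real.exp (-(ρ * tdistT M y y'))) := by
  classical
  haveI : NeZero (L ^ k) := ⟨pow_ne_zero k (NeZero.ne L)⟩
  have hL0 : 0 < L := Nat.pos_of_ne_zero (NeZero.ne L)
  have hn0 : (0 : ℝ) < ((L ^ k : ℕ) : ℝ) := by exact_mod_cast Nat.one_le_pow _ _ hL0
  have hE0 : ∀ y y' : Tor M, 0 ≤ Real.exp (-(ρ * tdistT M y y')) := fun _ _ => Real.exp_nonneg _
  have hid := hasMaj_id_blkFine (L := L) M k ρ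
  -- (i) `Q′*∘(Q′P − Q)`
  have h1 := hasMaj_qvRe_pull_sub_rough (L := L) M k m zero_le_one hρ hid
  have h1' : HasMaj (BlockNorm.ofBlocks (unitTorusGeo L k M) (blkFine L k M)) (BlockNorm.ofBlocks (unitTorusGeo L k M) (fun b : Tor M × Fin (d + 1) => b.1))
      ((qvRe M (L ^ m * L ^ k) ∘ₗ pull (kingPrV L k m M) - qvRe M (L ^ k)) ∘ₗ LinearMap.id)
      (fun y y' => (2 * Real.exp ρ / ((L ^ k : ℕ) : ℝ)) * Real.exp (-(ρ * tdistT M y y'))) :=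
    h1.mono fun y y' => le_of_eq (by ring)
  have hA := hasMaj_qvAdjRe_comp M k (L ^ m * L ^ k) (b₁ := BlockNorm.ofBlocks (unitTorusGeo L k M) (blkFine L k M)) (by positivity) hρ h1'
  -- (ii) `(Q′* − PQ*)∘Q`
  have hQ := hasMaj_qvRe_comp M k (L ^ k) (b₁ := BlockNorm.ofBlocks (unitTorusGeo L k M) (blkFine L k M)) zero_le_one hρ hid
  have hB := hasMaj_qvAdjRe_sub_pull_comp M k m (b₁ := BlockNorm.ofBlocks (unitTorusGeo L k M) (blkFine L k M)) (by positivity) hρ hQ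
  -- assembly
  have hsm := hasMaj_smul_ofBlocks (g := unitTorusGeo L k M) (b₁ := BlockNorm.ofBlocks (unitTorusGeo L k M) (blkFine L k M))
    (fun i : Tor (fine (L ^ m * L ^ k) M) × Fin (d + 1) => blockOf (L ^ m * L ^ k) M i.1) (fun y y' => by positivity) a (hA.add hB)
  refine (hsm.congr fun μ => ?_).mono fun y y' => le_of_eq ?_
  · rw [idef]
    simp only [LinearMap.smul_apply, LinearMap.add_apply, LinearMap.sub_apply, LinearMap.comp_apply, LinearMap.id_coe, id_eq,
      map_sub, map_smul, smul_sub, smul_add]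
    abel
  · have hLk : ((L ^ k : ℕ) : ℝ) = (L : ℝ) ^ k := by push_cast; ring
    simp only [hLk]
    ring

end Rough

end Summit.QuantumFields.YangMills.BalabanUVNodes.N15.TwoGrid
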